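import Summits.BirchSwinnertonDyer.BirchSwinnertonDyer.Theorems.ManinLocalTwoThreeManinPrimeToAdditiveFiveLeHorocyclicTransfer
import HarnessLib

/-!
# Route `ManinLocalTwoThree`, residual crux C5 `ManinPrimeToAdditiveFiveLe` (stmt-BirchSwinnertonDyer-22969),
# registered stub `stub_ord57` (stmt-27552), line «horocyclic-orientation»: **the CONVERSE horocyclic transfer in
# `ℤ[ℤ/p]`** (route-independent, Mathlib only; sequel of `…HorocyclicTransfer`)

Width seat bsd-line-ml23-c5-p1-w3 (gen 3). Part 1 (`…HorocyclicTransfer`) showed `(X − 1)^k ∈ (p, X^p − 1, r_χ)` in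
`ℤ[X]`, `r_χ = Σ_u χ_p(u) X^u`, `k = (p−1)/2`, whence «`r_χ` kills `h` mod `pΛ` ⟹ `(1 − X)^k` kills `h` mod `pΛ`» for
every `p`-periodic `Λ`-valued sequence `h`. Here the (easier) converse: `r_χ ∈ ((X − 1)^k, p)` — indeed
`r_χ(X + 1) = X^k · w` in `𝔽_p[X]` because its Taylor coefficients of order `< k` are the power sums
`Σ_u u^k C(u, m) = 0` (`m < k`, part 1 §1) — so «`(1 − X)^k` kills `h` mod `pΛ` ⟹ `r_χ` kills `h` mod `pΛ`». Together:
for a `Λ`-valued sequence `h`, **`Σ_u χ_p(u) h(j+u) ∈ pΛ ∀ j ⟺ Σ_{i≤k} (−1)^i C(k,i) h(j+i) ∈ pΛ ∀ j`** — the exact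
algebraic content of «BOTTOM ⟺ all horocyclic `k`-th differences vanish mod `p`» used by the curve-free dictionary
`…HorocyclicBottomIff` (Edixhoven's case 1 ⟺ `u`-shallowness, the line card's «EQUIVALENT … by
`stub_notBottom_of_horocyclic57` and its (unfiled) converse»).

Main results (sorry-free, no named facts):
* `horocyclic_X_pow_dvd_rchi_comp` — `X^k ∣ (Σ_u u^k X^u)(X + 1)` in `𝔽_p[X]`.
* `horocyclic_exists_rchi_eq_mul_int` — in `ℤ[X]`: `r_χ = v · (X − 1)^k + q` with `p ∣ q` coefficientwise.
* `horocyclic_transfer_abstract_converse` — `Σ_{i≤k} (−1)^i C(k,i) h(j+i) ∈ pΛ (∀ j)` ⟹ `Σ_u χ_p(u) h(j+u) ∈ pΛ (∀ j)`.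

Nothing about modular forms, C5, Manin's conjecture or BSD is proved in this file.

References: [MazurTateTeitelbaum1986Invent] §I.8; [Shimura1971] Prop. 3.64; crux dir
`Cruxes/ManinPrimeToAdditiveFiveLe/Lines/horocyclic-orientation.md`.
-/

set_option autoImplicit false
-- the Theorems namespace of this sub repeats the summit name by design (D-0017 nested layout)
set_option linter.dupNamespace false

noncomputable section

open scoped Classical Polynomial

namespace Summit.BirchSwinnertonDyer.BirchSwinnertonDyer.Theorems

open Polynomial Finset

section ConverseGroupRing

variable {p : ℕ} [hp : Fact p.Prime]

/-- `X^k ∣ r(X + 1)` in `𝔽_p[X]` for `r = Σ_{u ∈ 𝔽_p} u^k X^u`, `k = (p−1)/2`, `p` odd: the coefficient of `X^m` in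
`r(X+1)` is the power sum `Σ_u u^k C(u, m)`, which vanishes for `m < k`. [folklore] -/
theorem horocyclic_X_pow_dvd_rchi_comp (hp2 : p ≠ 2) :
    (X : (ZMod p)[X]) ^ ((p - 1) / 2) ∣
      (∑ u : ZMod p, C (u ^ ((p - 1) / 2)) * X ^ u.val).comp (X + 1) := by
  have hodd : p % 2 = 1 := Nat.odd_iff.mp (hp.out.eq_two_or_odd'.resolve_left hp2)
  set k : ℕ := (p - 1) / 2 with hk
  have hkp : 2 * k + 1 = p := by omega
  have hR : (∑ u : ZMod p, C (u ^ k) * X ^ u.val).comp (X + 1) = ∑ u : ZMod p, C (u ^ k) * (X + 1) ^ u.val := by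
    rw [← Polynomial.coe_compRingHom_apply, map_sum]
    refine Finset.sum_congr rfl fun u _ ↦ ?_
    rw [Polynomial.coe_compRingHom_apply, Polynomial.mul_comp, Polynomial.C_comp, Polynomial.X_pow_comp]
  refine Polynomial.X_pow_dvd_iff.mpr fun m hm ↦ ?_
  rw [hR, Polynomial.finsetSum_coeff]
  have e : ∑ u : ZMod p, (C (u ^ k) * (X + 1) ^ u.val).coeff m =
      ∑ u : ZMod p, u ^ k * ((u.val.choose m : ℕ) : ZMod p) :=
    Finset.sum_congr rfl fun u _ ↦ by rw [Polynomial.coeff_C_mul, Polynomial.coeff_X_add_one_pow]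
  rw [e]
  exact horocyclic_sum_pow_mul_choose_eq_zero hkp.le hm

/-- Over `𝔽_p`: `Σ_u u^k X^u = (X − 1)^k · w` for some `w ∈ 𝔽_p[X]` (substitute `X ↦ X − 1` in
`horocyclic_X_pow_dvd_rchi_comp`). [folklore] -/
theorem horocyclic_exists_rchi_eq_mul_zmod (hp2 : p ≠ 2) :
    ∃ w : (ZMod p)[X], (∑ u : ZMod p, C (u ^ ((p - 1) / 2)) * X ^ u.val) = (X - 1) ^ ((p - 1) / 2) * w := by
  obtain ⟨w, hw⟩ := horocyclic_X_pow_dvd_rchi_comp (p := p) hp2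
  refine ⟨w.comp (X - 1), ?_⟩
  have hcomp : ((∑ u : ZMod p, C (u ^ ((p - 1) / 2)) * X ^ u.val).comp (X + 1)).comp (X - 1) =
      ((X : (ZMod p)[X]) ^ ((p - 1) / 2) * w).comp (X - 1) := by rw [hw]
  rwa [Polynomial.comp_assoc, Polynomial.add_comp, Polynomial.X_comp, Polynomial.one_comp, sub_add_cancel,
    Polynomial.comp_X, Polynomial.mul_comp, Polynomial.X_pow_comp] at hcomp

/-- Over `ℤ`: `r_χ = Σ_u χ_p(u) X^u = v · (X − 1)^k + q` with every coefficient of `q` divisible by `p`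
(`χ_p` = Legendre symbol; lift of the `𝔽_p` identity through Euler's criterion `χ_p(u) ≡ u^k`). [folklore] -/
theorem horocyclic_exists_rchi_eq_mul_int (hp2 : p ≠ 2) :
    ∃ v q : ℤ[X], (∀ n, (p : ℤ) ∣ q.coeff n) ∧
      (∑ u : ZMod p, C ((quadraticChar (ZMod p) u : ℤ)) * X ^ u.val) = v * (X - 1) ^ ((p - 1) / 2) + q := by
  have hodd : p % 2 = 1 := Nat.odd_iff.mp (hp.out.eq_two_or_odd'.resolve_left hp2)
  set k : ℕ := (p - 1) / 2 with hk
  have hk2 : p / 2 = k := by omega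
  obtain ⟨w, hw⟩ := horocyclic_exists_rchi_eq_mul_zmod (p := p) hp2
  have hsurj : Function.Surjective (Int.castRingHom (ZMod p)) := ZMod.intCast_surjective
  obtain ⟨V, hV⟩ := Polynomial.map_surjective _ hsurj w
  set r : ℤ[X] := ∑ u : ZMod p, C ((quadraticChar (ZMod p) u : ℤ)) * X ^ u.val with hr
  have hF : ringChar (ZMod p) ≠ 2 := by rw [ZMod.ringChar_zmod_n]; exact hp2
  have hrmap : r.map (Int.castRingHom (ZMod p)) = ∑ u : ZMod p, C (u ^ k) * X ^ u.val := by
    rw [hr, Polynomial.map_sum]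
    refine Finset.sum_congr rfl fun u _ ↦ ?_
    rw [Polynomial.map_mul, Polynomial.map_pow, Polynomial.map_X, Polynomial.map_C, eq_intCast,
      quadraticChar_eq_pow_of_char_ne_two' hF, ZMod.card, hk2]
  set q : ℤ[X] := r - V * (X - 1) ^ k with hq
  refine ⟨V, q, fun n ↦ ?_, by rw [hq]; ring⟩
  have hmap : q.map (Int.castRingHom (ZMod p)) = 0 := by
    rw [hq, Polynomial.map_sub, Polynomial.map_mul, hV, hrmap]
    simp only [Polynomial.map_pow, Polynomial.map_sub, Polynomial.map_X, Polynomial.map_one]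
    rw [hw, mul_comm, sub_self]
  have hc := congrArg (fun s : (ZMod p)[X] ↦ s.coeff n) hmap
  simp only [Polynomial.coeff_map, Polynomial.coeff_zero, eq_intCast] at hc
  exact (ZMod.intCast_zmod_eq_zero_iff_dvd _ p).mp hc

end ConverseGroupRing

section ConverseTransfer

variable {M : Type*} [AddCommGroup M]

/-- **Abstract horocyclic transfer, converse.** Let `p` be an odd prime, `k = (p−1)/2`, `Λ ≤ M` and `h : ℤ → Λ`.
If every horocyclic `k`-th difference `Σ_{i≤k} (−1)^i C(k,i) h(j+i)` lies in `p·Λ`, then so does every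
`Σ_{u mod p} χ_p(u) h(j+u)` (`χ_p` = Legendre). Proof: `r_χ = v·(X−1)^k + q`, `p ∣ q`
(`horocyclic_exists_rchi_eq_mul_int`), and the polynomials acting into `pΛ` form an ideal (part 1 §3); no
periodicity is needed in this direction. [folklore] -/
theorem horocyclic_transfer_abstract_converse (Λ : AddSubgroup M) {p : ℕ} [hp : Fact p.Prime] (hp2 : p ≠ 2)
    (h : ℤ → M) (hmem : ∀ n, h n ∈ Λ)
    (hdiff : ∀ j : ℤ, ∃ y ∈ Λ, ∑ i ∈ Finset.range ((p - 1) / 2 + 1),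
      ((-1) ^ i * (((p - 1) / 2).choose i : ℕ) : ℤ) • h (j + i) = (p : ℤ) • y)
    (j : ℤ) :
    ∃ y ∈ Λ, ∑ u : ZMod p, (quadraticChar (ZMod p) u : ℤ) • h (j + u.val) = (p : ℤ) • y := by
  set T := LinearMap.funLeft ℤ M (fun i : ℤ ↦ i + 1) with hT
  set PΛ : AddSubgroup M := Λ.map (zsmulAddGroupHom (p : ℤ)) with hPΛ
  have memPΛ : ∀ x, x ∈ PΛ ↔ ∃ y ∈ Λ, (p : ℤ) • y = x := fun x ↦ by
    simp only [hPΛ, AddSubgroup.mem_map, zsmulAddGroupHom_apply]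
  set k : ℕ := (p - 1) / 2 with hk
  set r : ℤ[X] := ∑ u : ZMod p, C ((quadraticChar (ZMod p) u : ℤ)) * X ^ u.val with hr
  obtain ⟨v, q, hq, hid⟩ := horocyclic_exists_rchi_eq_mul_int (p := p) hp2
  -- `(1 - X)^k` acts into `pΛ` by hypothesis
  have hexp : ((1 : ℤ[X]) - X) ^ k = ∑ i ∈ Finset.range (k + 1), C ((-1) ^ i * (k.choose i : ℕ) : ℤ) * X ^ i := by
    rw [sub_eq_add_neg, add_comm, add_pow]
    refine Finset.sum_congr rfl fun i _ ↦ ?_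
    rw [one_pow, mul_one, neg_pow, map_mul, map_pow, map_neg, map_one, map_natCast]
    ring
  have Hdiff : ∀ j, (aeval T (((1 : ℤ[X]) - X) ^ k) h) j ∈ PΛ := by
    intro j
    rw [hexp, hT, horocyclic_aeval_shift_sum_apply]
    obtain ⟨y, hy, e⟩ := hdiff j
    exact (memPΛ _).mpr ⟨y, hy, e.symm⟩
  have Hq : ∀ j, (aeval T q h) j ∈ PΛ := by
    intro j
    rw [Polynomial.aeval_eq_sum_range, LinearMap.sum_apply, Finset.sum_apply]
    refine PΛ.sum_mem fun i _ ↦ ?_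
    obtain ⟨c, hc⟩ := hq i
    rw [LinearMap.smul_apply, Pi.smul_apply, hT, horocyclic_shift_pow_apply, hc, mul_smul]
    exact (memPΛ _).mpr ⟨c • h (j + i), Λ.zsmul_mem (hmem _) c, rfl⟩
  -- hence `r = ((-1)^k v) (1 - X)^k + q` does
  have Hr : (aeval T r h) j ∈ PΛ := by
    have e : r = ((-1) ^ k * v) * ((1 : ℤ[X]) - X) ^ k + q := by
      rw [hr, hid, show ((1 : ℤ[X]) - X) ^ k = (-1) ^ k * (X - 1) ^ k by rw [← mul_pow]; congr 1; ring]
      rw [← mul_assoc, mul_assoc ((-1) ^ k) v, mul_comm v ((-1) ^ k), ← mul_assoc, ← mul_pow,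
        neg_one_mul, neg_neg, one_pow, one_mul]
    rw [e, map_add, LinearMap.add_apply, Pi.add_apply]
    exact PΛ.add_mem (horocyclic_aeval_mul_apply_mem PΛ h _ Hdiff _ j) (Hq j)
  rw [hr, hT, horocyclic_aeval_shift_sum_apply] at Hr
  obtain ⟨y, hy, e⟩ := (memPΛ _).mp Hr
  exact ⟨y, hy, e.symm⟩

end ConverseTransfer

end Summit.BirchSwinnertonDyer.BirchSwinnertonDyer.Theorems

end
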